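import Summits.QuantumFields.BalabanUV.Beta.SpineRecursiveWEnd

/-!
# `BalabanUV.Beta.SpineRecursiveWLaw` — binder row D1, (L4) piece (W-E) EVALUATION, part 3d: **THE W-LAW AT LEVEL `j` FROM (hT2-rem) AT
# LEVEL `j`** — the body of the (W-ASM) root `SpineRecursiveWEnd`, exposed as a standalone lemma in exactly the shape consumed by the level
# step `SpineRecursiveT2Step.T2RecAt_succ_bref_of_laws` (β sub-cell, row BETA-an2 = BINDER-OWNERS row D1 OWNER, lineage an2 gen 18)

HONEST FRAMING (cell charter, verbatim): «discharging BetaPertH makes Balaban's UV stability UNCONDITIONAL — a real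
constructive-QFT result; it is NOT the continuum limit and NOT the Clay problem.»  DERIVED cell leaf (wiring, [folklore]); no statement of
Bałaban's papers, no `[cite:]`, no `def`, no `Prop` fact; instantiates no binder of the wall.  NOT D1, NOT `BetaPertH`, NOT continuum, NOT Clay.

## What is here (`d + 1 = 4`, odd `Lc`, centred root, pin `(cE, cVH) = (Lc⁴, −Lc⁸/2)`, `G_j`, `𝕄_j := bhKStepAt 3 ρ_c Lc j`, `γ_j := −(Lc⁸/2)·wVH j/(stepScale j·Lc⁴)`)

**`WrecAt_bref_of_T2`**: for one level `j` and one axis `α`, from (hT2-rem) the sharp law of `T2RecAt j` with ♯-bi-table of similarity shape up to a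
remainder `R2`, (hM2) the sharp law of `M2Of mixFF j` (an1's letter), (hsplit) the two orientations of the assembled split identity for these ♯-tables
(`SecondOrderContactAssembly.W2OfK_sharp_split` + `vertex2OfK`-additivity, residual family `Δ`), and (hDg) the localisation of `dM G_j Lc S♯ M_j ·`:
`WrecAt … j μ (bref y) ν (bref y′) = (ε ε) • refK (WrecAt … j μ y ν y′ + conjW 𝕄_j (dM G_j Lc Sp_j M_j μ y) (dM … ν y′) (diagK G^γ_{μy}) (diagK G^γ_{νy′}) (diagK (X2s μ y ν y′))
   + (½•conjV 𝕄_j (diagK (X2s ν y′ μ y − X2s μ y ν y′)) + ½•(Δ μ y ν y′ + Δ ν y′ μ y)))` —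
LITERALLY the hypothesis (hWlaw) of `T2RecAt_succ_bref_of_laws` with `Rm := ½•conjV … + ½•(Δ + Δᵀ)`; and `loc_WRem` / `tadpole_WRem_eq_zero`: that `Rm`
is localised and tadpole-null against `G_j` given `Loc (diagK X2s)`, `Loc Δ`, `tadpole G_j Δ = 0` (the pieces of `SpineRecursiveWEnd`'s proof, by name).
So the level cycle reads: (hT2-rem)(j) —`WrecAt_bref_of_T2`→ W-law(j) —`T2RecAt_succ_bref_of_laws`→ (hT2-rem)(j+1).
Provenance: β sub-cell, unit beta-an2 gen 18, 2026-08-20 (v1); no existing file touched.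
-/

open Finset
open scoped BigOperators
open Literature.MathematicalPhysics.QuantumFieldTheory
open Literature.MathematicalPhysics.QuantumFieldTheory.Balaban1983to89
open Literature.MathematicalPhysics.QuantumFieldTheory.Balaban1983to89.Beta
open ExpKernelCalculus (MKer Decays BiLoc comp tadpole VertexFamily VertexFamily₂ shiftK)
open AffineAveraging (box toSite)
open AveragingContoursRooted (ctr ctrOff ctrOff_mem_box)
open PolarizationSign (reflSign AxisReflectionCovariant)
open KernelReflection (refK refK_apply)
open ResolventReflection (bref Φ)
open OneStepResolventKernel (Fib LocStencil JetData wsum)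
open OneStepKernelFamily (KInvStep colH vertexOfK TbalOf flipK)
open BalabanStepJetsSucc (wE wVH)
open BalabanCompositeJets (LocStencil₂)
open BalabanStepW2 (M2Of)
open SecondOrderResponse (dM W2OfK W2SymOfK LocStencilFM)
open Summit.QuantumFields.BalabanUV.Beta.TameKernelCalculus
open Summit.QuantumFields.BalabanUV.Beta.ChartConjugation (conjV conjW loc_conjV)
open Summit.QuantumFields.BalabanUV.Beta.ChartConjugationRelative (RelInv)
open Summit.QuantumFields.BalabanUV.Beta.AxialDressingRooted (coDressKBmAt axEc spr_axEc one_le_of_neZero refK_coDressKBmAt_KInvStep)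
open Summit.QuantumFields.BalabanUV.Beta.BorderedHessian (diagK diagK_apply ctGen comp_axEc_diagK_comm bhKStepAt stepScale spr_bhKStepAt
  relInv_coDressKBmAt_KInvStep_bhKStepAt)
open Summit.QuantumFields.BalabanUV.Beta.WardLocusRecursive (SrecAt SrecAt_zero)
open Summit.QuantumFields.BalabanUV.Beta.VertexReflectionContact (smul_diagK)
open Summit.QuantumFields.BalabanUV.Beta.SecondOrderTransport (W2SymOfK_bref_sharp)
open Summit.QuantumFields.BalabanUV.Beta.SecondOrderSymContact (W2SymOfK_sharp_split_of tadpole_conjV_rel_eq_zero tadpole_rem_eq_zero loc_rem)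
open Summit.QuantumFields.BalabanUV.Beta.LagrangeFoldSrec (vertexOfK_S0NAt_split vertexOfK_SrecAt_succ_split)

noncomputable section

namespace Summit.QuantumFields.BalabanUV.Beta.SpineRooted

section Wall

variable {Lc : ℕ} [NeZero Lc]

/-- [folklore] **THE W-LAW OF `WrecAt j` FROM (hT2-rem), (hM2), (hsplit), (hDg) AT LEVEL `j`** (see the module docstring). -/
theorem WrecAt_bref_of_T2 (hLc : Odd Lc) (cΛ cE₂ cB : ℝ) (T : Fin 4 → Fin 4 → Fin 4 → Fin 4 → ℝ)
    (vh₂S mixFF : Fin 4 → (Fin 4 → ℤ) → Fin 4 → (Fin 4 → ℤ) → MKer 4 (Fib 3))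
    (γ : ℕ → ℝ) (hγ : ∀ j, γ j = -((Lc : ℝ) ^ 8 / 2) * wVH 3 Lc j / (stepScale 3 Lc j * (Lc : ℝ) ^ 4)) (j : ℕ) (α : Fin 4)
    (h : Fin 4 → (Fin 4 → ℤ) → Fin 4 → (Fin 4 → ℤ) → (Fin 4 → ℤ) → Fib 3 → ℝ) (R2 : Fin 4 → (Fin 4 → ℤ) → Fin 4 → (Fin 4 → ℤ) → MKer 4 (Fib 3))
    (hT2 : ∀ (κ : Fin 4) (u : Fin 4 → ℤ) (κ' : Fin 4) (u' : Fin 4 → ℤ),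
      T2RecAt 3 Lc (toSite (ctrOff 4 Lc)) ((Lc : ℝ) ^ 4) (-((Lc : ℝ) ^ 8 / 2)) cΛ cE₂ cB T vh₂S mixFF j κ (bref α κ u) κ' (bref α κ' u') =
        (reflSign α κ * reflSign α κ') • refK (Φ Lc α)
          (T2RecAt 3 Lc (toSite (ctrOff 4 Lc)) ((Lc : ℝ) ^ 4) (-((Lc : ℝ) ^ 8 / 2)) cΛ cE₂ cB T vh₂S mixFF j κ u κ' u' +
            conjW (bhKStepAt 3 (toSite (ctrOff 4 Lc)) Lc j)
              (SpureRecAt 3 Lc (toSite (ctrOff 4 Lc)) ((Lc : ℝ) ^ 4) (-((Lc : ℝ) ^ 8 / 2)) cΛ j κ u)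
              (SpureRecAt 3 Lc (toSite (ctrOff 4 Lc)) ((Lc : ℝ) ^ 4) (-((Lc : ℝ) ^ 8 / 2)) cΛ j κ' u')
              (diagK fun p c => γ j * ctGen 3 α Lc κ u p c) (diagK fun p c => γ j * ctGen 3 α Lc κ' u' p c) (diagK (h κ u κ' u')) +
            R2 κ u κ' u'))
    (hM2 : ∀ (κ : Fin 4) (u : Fin 4 → ℤ) (ρ : Fin 4) (w : Fin 4 → ℤ),
      M2Of 3 Lc mixFF j κ (bref α κ u) ρ (bref α ρ w) =
        (reflSign α κ * reflSign α ρ) • refK (Φ Lc α)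
          (M2Of 3 Lc mixFF j κ u ρ w + conjV (M1At 3 Lc (toSite (ctrOff 4 Lc)) cΛ j ρ w) (diagK fun p c => γ j * ctGen 3 α Lc κ u p c)))
    (X2s : Fin 4 → (Fin 4 → ℤ) → Fin 4 → (Fin 4 → ℤ) → (Fin 4 → ℤ) → Fib 3 → ℝ)
    (Δ : Fin 4 → (Fin 4 → ℤ) → Fin 4 → (Fin 4 → ℤ) → MKer 4 (Fib 3))
    (hsplit : ∀ (μ : Fin 4) (y : Fin 4 → ℤ) (ν : Fin 4) (y' : Fin 4 → ℤ),
      W2OfK (coDressKBmAt (toSite (ctrOff 4 Lc)) Lc (KInvStep (d := 3) Lc j)) Lc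
          (fun κ u => SpureRecAt 3 Lc (toSite (ctrOff 4 Lc)) ((Lc : ℝ) ^ 4) (-((Lc : ℝ) ^ 8 / 2)) cΛ j κ u +
            conjV (bhKStepAt 3 (toSite (ctrOff 4 Lc)) Lc j) (diagK fun p c => γ j * ctGen 3 α Lc κ u p c))
          (M1At 3 Lc (toSite (ctrOff 4 Lc)) cΛ j)
          (fun κ u κ' u' => T2RecAt 3 Lc (toSite (ctrOff 4 Lc)) ((Lc : ℝ) ^ 4) (-((Lc : ℝ) ^ 8 / 2)) cΛ cE₂ cB T vh₂S mixFF j κ u κ' u' +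
            conjW (bhKStepAt 3 (toSite (ctrOff 4 Lc)) Lc j)
              (SpureRecAt 3 Lc (toSite (ctrOff 4 Lc)) ((Lc : ℝ) ^ 4) (-((Lc : ℝ) ^ 8 / 2)) cΛ j κ u)
              (SpureRecAt 3 Lc (toSite (ctrOff 4 Lc)) ((Lc : ℝ) ^ 4) (-((Lc : ℝ) ^ 8 / 2)) cΛ j κ' u')
              (diagK fun p c => γ j * ctGen 3 α Lc κ u p c) (diagK fun p c => γ j * ctGen 3 α Lc κ' u' p c) (diagK (h κ u κ' u')) +
            R2 κ u κ' u')
          (fun κ u ρ w => M2Of 3 Lc mixFF j κ u ρ w + conjV (M1At 3 Lc (toSite (ctrOff 4 Lc)) cΛ j ρ w) (diagK fun p c => γ j * ctGen 3 α Lc κ u p c))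
          μ y ν y' =
        W2OfK (coDressKBmAt (toSite (ctrOff 4 Lc)) Lc (KInvStep (d := 3) Lc j)) Lc
            (SpureRecAt 3 Lc (toSite (ctrOff 4 Lc)) ((Lc : ℝ) ^ 4) (-((Lc : ℝ) ^ 8 / 2)) cΛ j) (M1At 3 Lc (toSite (ctrOff 4 Lc)) cΛ j)
            (T2RecAt 3 Lc (toSite (ctrOff 4 Lc)) ((Lc : ℝ) ^ 4) (-((Lc : ℝ) ^ 8 / 2)) cΛ cE₂ cB T vh₂S mixFF j) (M2Of 3 Lc mixFF j) μ y ν y' +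
          conjW (bhKStepAt 3 (toSite (ctrOff 4 Lc)) Lc j)
            (dM (coDressKBmAt (toSite (ctrOff 4 Lc)) Lc (KInvStep (d := 3) Lc j)) Lc
              (SpureRecAt 3 Lc (toSite (ctrOff 4 Lc)) ((Lc : ℝ) ^ 4) (-((Lc : ℝ) ^ 8 / 2)) cΛ j) (M1At 3 Lc (toSite (ctrOff 4 Lc)) cΛ j) μ y)
            (dM (coDressKBmAt (toSite (ctrOff 4 Lc)) Lc (KInvStep (d := 3) Lc j)) Lc
              (SpureRecAt 3 Lc (toSite (ctrOff 4 Lc)) ((Lc : ℝ) ^ 4) (-((Lc : ℝ) ^ 8 / 2)) cΛ j) (M1At 3 Lc (toSite (ctrOff 4 Lc)) cΛ j) ν y')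
            (diagK fun p c => ∑ κ, ∑' u, colH (coDressKBmAt (toSite (ctrOff 4 Lc)) Lc (KInvStep (d := 3) Lc j)) Lc μ y κ u * (γ j * ctGen 3 α Lc κ u p c))
            (diagK fun p c => ∑ κ, ∑' u, colH (coDressKBmAt (toSite (ctrOff 4 Lc)) Lc (KInvStep (d := 3) Lc j)) Lc ν y' κ u * (γ j * ctGen 3 α Lc κ u p c))
            (diagK (X2s μ y ν y')) +
          Δ μ y ν y')
    (hDg : ∀ (ν : Fin 4) (y' : Fin 4 → ℤ),
      Loc (dM (coDressKBmAt (toSite (ctrOff 4 Lc)) Lc (KInvStep (d := 3) Lc j)) Lc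
        (fun κ u => SpureRecAt 3 Lc (toSite (ctrOff 4 Lc)) ((Lc : ℝ) ^ 4) (-((Lc : ℝ) ^ 8 / 2)) cΛ j κ u +
          conjV (bhKStepAt 3 (toSite (ctrOff 4 Lc)) Lc j) (diagK fun p c => γ j * ctGen 3 α Lc κ u p c))
        (M1At 3 Lc (toSite (ctrOff 4 Lc)) cΛ j) ν y'))
    (μ : Fin 4) (y : Fin 4 → ℤ) (ν : Fin 4) (y' : Fin 4 → ℤ) :
    WrecAt 3 Lc (toSite (ctrOff 4 Lc)) ((Lc : ℝ) ^ 4) (-((Lc : ℝ) ^ 8 / 2)) cΛ cE₂ cB T vh₂S mixFF j μ (bref α μ y) ν (bref α ν y') =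
      (reflSign α μ * reflSign α ν) • refK (Φ Lc α)
        (WrecAt 3 Lc (toSite (ctrOff 4 Lc)) ((Lc : ℝ) ^ 4) (-((Lc : ℝ) ^ 8 / 2)) cΛ cE₂ cB T vh₂S mixFF j μ y ν y' +
          conjW (bhKStepAt 3 (toSite (ctrOff 4 Lc)) Lc j)
            (dM (coDressKBmAt (toSite (ctrOff 4 Lc)) Lc (KInvStep (d := 3) Lc j)) Lc
              (SpureRecAt 3 Lc (toSite (ctrOff 4 Lc)) ((Lc : ℝ) ^ 4) (-((Lc : ℝ) ^ 8 / 2)) cΛ j) (M1At 3 Lc (toSite (ctrOff 4 Lc)) cΛ j) μ y)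
            (dM (coDressKBmAt (toSite (ctrOff 4 Lc)) Lc (KInvStep (d := 3) Lc j)) Lc
              (SpureRecAt 3 Lc (toSite (ctrOff 4 Lc)) ((Lc : ℝ) ^ 4) (-((Lc : ℝ) ^ 8 / 2)) cΛ j) (M1At 3 Lc (toSite (ctrOff 4 Lc)) cΛ j) ν y')
            (diagK fun p c => ∑ κ, ∑' u, colH (coDressKBmAt (toSite (ctrOff 4 Lc)) Lc (KInvStep (d := 3) Lc j)) Lc μ y κ u * (γ j * ctGen 3 α Lc κ u p c))
            (diagK fun p c => ∑ κ, ∑' u, colH (coDressKBmAt (toSite (ctrOff 4 Lc)) Lc (KInvStep (d := 3) Lc j)) Lc ν y' κ u * (γ j * ctGen 3 α Lc κ u p c))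
            (diagK (X2s μ y ν y')) +
          ((1 / 2 : ℝ) • conjV (bhKStepAt 3 (toSite (ctrOff 4 Lc)) Lc j) (diagK fun p a => X2s ν y' μ y p a - X2s μ y ν y' p a) +
            (1 / 2 : ℝ) • (Δ μ y ν y' + Δ ν y' μ y))) := by
  have hL1 : 1 ≤ Lc := hLc.pos
  have hr := ctrOff_mem_box (d := 4) hL1
  have hn : 2 * (-((Lc : ℝ) ^ 8 / 2)) = -((Lc : ℝ) ^ 4 * (Lc : ℝ) ^ 4) := by ring
  have hlock : ∀ j, (Lc : ℝ) ^ 4 * wE 3 Lc (j + 1) * (γ j / (stepScale 3 Lc j * (Lc : ℝ) ^ 4 * wVH 3 Lc (j + 1))) = γ (j + 1) := by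
    intro j; rw [hγ, hγ]; exact locks_of_pin (Lc := Lc) ((Lc : ℝ) ^ 4) (-((Lc : ℝ) ^ 8 / 2)) (pin_of_bcj (Lc := Lc) _ rfl) j
  have hSp := SpureRecAt_bref hLc ((Lc : ℝ) ^ 4) (-((Lc : ℝ) ^ 8 / 2)) cΛ hn γ hγ hlock
  unfold WrecAt
  rw [W2SymOfK_bref_sharp (refK_coDressKBmAt_KInvStep (d := 3) hLc j α) (spr_stepProp hr j) (hSp j α) (M1At_bref (d := 3) hLc cΛ j α)
      hT2 hM2 hDg μ y ν y', W2SymOfK_sharp_split_of (hsplit μ y ν y') (hsplit ν y' μ y)]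

/-- [folklore] **THE W-REMAINDER IS LOCALISED** (given `Loc (diagK X2s)` and `Loc Δ`). -/
theorem loc_WRem {j : ℕ} {X2s : Fin 4 → (Fin 4 → ℤ) → Fin 4 → (Fin 4 → ℤ) → (Fin 4 → ℤ) → Fib 3 → ℝ}
    {Δ : Fin 4 → (Fin 4 → ℤ) → Fin 4 → (Fin 4 → ℤ) → MKer 4 (Fib 3)} (hLc : 1 ≤ Lc)
    (hX2L : ∀ μ y ν y', Loc (diagK (X2s μ y ν y'))) (hΔL : ∀ μ y ν y', Loc (Δ μ y ν y')) (μ : Fin 4) (y : Fin 4 → ℤ) (ν : Fin 4) (y' : Fin 4 → ℤ) :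
    Loc ((1 / 2 : ℝ) • conjV (bhKStepAt 3 (toSite (ctrOff 4 Lc)) Lc j) (diagK fun p a => X2s ν y' μ y p a - X2s μ y ν y' p a) +
      (1 / 2 : ℝ) • (Δ μ y ν y' + Δ ν y' μ y)) := by
  have hdiff : Loc (diagK fun p a => X2s ν y' μ y p a - X2s μ y ν y' p a) := by
    rw [diagK_sub]; exact (hX2L ν y' μ y).sub (hX2L μ y ν y')
  exact loc_rem (loc_conjV (spr_bhKStepAt (ctrOff_mem_box (d := 4) hLc) j) hdiff) (hΔL μ y ν y') (hΔL ν y' μ y)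

/-- [folklore] **THE W-REMAINDER IS TADPOLE-NULL AGAINST `G_j`** (given `Loc (diagK X2s)`, `Loc Δ`, `tadpole G_j Δ = 0`): its `conjV`-part by the
relative-inverse rules (`tadpole_conjV_rel_eq_zero`), its `Δ`-part by hypothesis. -/
theorem tadpole_WRem_eq_zero {j : ℕ} {X2s : Fin 4 → (Fin 4 → ℤ) → Fin 4 → (Fin 4 → ℤ) → (Fin 4 → ℤ) → Fib 3 → ℝ}
    {Δ : Fin 4 → (Fin 4 → ℤ) → Fin 4 → (Fin 4 → ℤ) → MKer 4 (Fib 3)} (hLc : 1 ≤ Lc)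
    (hX2L : ∀ μ y ν y', Loc (diagK (X2s μ y ν y'))) (hΔL : ∀ μ y ν y', Loc (Δ μ y ν y'))
    (hΔ0 : ∀ μ y ν y', tadpole (coDressKBmAt (toSite (ctrOff 4 Lc)) Lc (KInvStep (d := 3) Lc j)) (Δ μ y ν y') = 0)
    (μ : Fin 4) (y : Fin 4 → ℤ) (ν : Fin 4) (y' : Fin 4 → ℤ) :
    tadpole (coDressKBmAt (toSite (ctrOff 4 Lc)) Lc (KInvStep (d := 3) Lc j))
      ((1 / 2 : ℝ) • conjV (bhKStepAt 3 (toSite (ctrOff 4 Lc)) Lc j) (diagK fun p a => X2s ν y' μ y p a - X2s μ y ν y' p a) +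
        (1 / 2 : ℝ) • (Δ μ y ν y' + Δ ν y' μ y)) = 0 := by
  have hr := ctrOff_mem_box (d := 4) hLc
  have hdiff : Loc (diagK fun p a => X2s ν y' μ y p a - X2s μ y ν y' p a) := by
    rw [diagK_sub]; exact (hX2L ν y' μ y).sub (hX2L μ y ν y')
  exact tadpole_rem_eq_zero (spr_stepProp hr j) (loc_conjV (spr_bhKStepAt hr j) hdiff) (hΔL μ y ν y') (hΔL ν y' μ y)
    (tadpole_conjV_rel_eq_zero (spr_stepProp hr j) (spr_bhKStepAt hr j) (spr_axEc _ _) (relInv_coDressKBmAt_KInvStep_bhKStepAt (d := 3) (Lc := Lc) hr j)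
      hdiff (comp_axEc_diagK_comm _ _ _)) (hΔ0 μ y ν y') (hΔ0 ν y' μ y)

end Wall

end Summit.QuantumFields.BalabanUV.Beta.SpineRooted

end
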